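import Mathlib
import HarnessLib
import Summits.Ventures.LatticeQCDFlow.Exactness.SphereLuscherSeriesSolver

/-!
# The universal solver polynomial does not depend on the lattice: `labelSet Λ E N = labelSet Λ' E N` and `q_N(Λ) = q_N(Λ')` for any two finite lattices with at least `N` sites

HONEST FRAMING: exact (Metropolis-corrected) sampling algorithms for lattice gauge theory;
figures of merit are autocorrelation/cost numbers at stated couplings and volumes; no
continuum-physics claim.

Venture `LatticeQCDFlow` (cell pub-lqcd), topic `Exactness`; FANOUT row 7 (`s0-cpn-null`: the
S0-D1 rung — 2D CP⁹, Lüscher's LO trivializing map inside HMC, Engel–Schaefer 2011).  NEW WORK of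
the cell over the tree's `Exactness/LatticeSitePolynomialOperator.lean` (`siteCount`, `eigLabel`)
and `Exactness/SphereLuscherSeriesSolver.lean` (`labelSet`, `solverPoly`); nothing is cited as a
fact.  Printed counterpart, NAMED ONLY: M. Lüscher, Commun. Math. Phys. 293 (2010) 899, §4.4–§4.5
(locality and volume behaviour of the perturbative flow action); Engel–Schaefer, Comput. Phys.
Commun. 182 (2011) 2107, §3.

## Content (`E` finite-dimensional, `d = dim E`; `Λ`, `Λ'` finite)

* `eigLabel_eq_sum_factors` — THE LABEL READ OFF THE FACTORS: `λ(κs) = Σ_j (c_{site j} + d − 2)`,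
  `c_{site j} = #{j' : site j' = site j}`: the label of a site monomial depends only on WHICH FACTORS
  SHARE A SITE (`eigLabel_eq_of_sameSite`), not on the lattice.
* `eigLabel_map_embedding` (relabelling the sites along an injection preserves the label),
  **`labelSet_subset_of_embedding`** (`Λ ↪ Λ' ⇒ labelSet Λ N ⊆ labelSet Λ' N`),
  **`exists_eigLabel_eq_of_le_card`** (any label of degree `≤ |Λ|` over ANY lattice `Λ'` is a label
  over `Λ`: compress the at most `k` used sites into `Λ`).
* **`labelSet_eq_of_le_card`** — for `N ≤ |Λ|` and `N ≤ |Λ'|`, `labelSet Λ E N = labelSet Λ' E N`;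
  **`solverPoly_eq_of_le_card`** — THE UNIVERSAL SOLVER POLYNOMIAL `q_N` OF
  `SphereLuscherSeriesSolver` IS LITERALLY THE SAME POLYNOMIAL FOR ALL FINITE LATTICES WITH AT LEAST
  `N` SITES (so for the Engel–Schaefer series at order `k`, `q_{2(k+1)}` is fixed once
  `|Λ| ≥ 2(k+1)`: the algebra of every order is volume-independent, only the source carries `Λ`).

NOT CLAIMED: the value of `|labelSet N|` or of `deg q_N`; anything about flows or the rung's numbers.
-/

noncomputable section

namespace Summit.Ventures.LatticeQCDFlow.Exactness

open Function Set Polynomial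

variable {Λ Λ' : Type*} {E : Type*} [NormedAddCommGroup E] [InnerProductSpace ℝ E]
variable [Fintype Λ] [DecidableEq Λ] [Fintype Λ'] [DecidableEq Λ']

/-! ## §1 The label depends only on the same-site relation among the factors -/

section SameSite

omit [Fintype Λ'] [DecidableEq Λ'] in
/-- **The label read off the factors**: `λ(κs) = Σ_j (#{j' : site j' = site j} + d − 2)`. -/
theorem eigLabel_eq_sum_factors {k : ℕ} (κs : Fin k → SiteCoord Λ E) :
    eigLabel κs = ∑ j : Fin k,
      ((∑ j' : Fin k, if (κs j').1 = (κs j).1 then (1 : ℝ) else 0) +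
        (Module.finrank ℝ E : ℝ) - 2) := by
  unfold eigLabel
  -- `c_n (c_n + d − 2) = Σ_j [site j = n] (c_n + d − 2)`, then swap the sums
  have h1 : ∀ n : Λ, siteCount n κs * (siteCount n κs + (Module.finrank ℝ E : ℝ) - 2) =
      ∑ j : Fin k, if (κs j).1 = n then (siteCount n κs + (Module.finrank ℝ E : ℝ) - 2) else 0 := by
    intro n
    rw [← Finset.sum_filter, Finset.sum_const, nsmul_eq_mul, siteCount_eq_card]
  simp_rw [h1]
  rw [Finset.sum_comm]
  refine Finset.sum_congr rfl fun j _ => ?_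
  rw [Finset.sum_ite_eq Finset.univ (κs j).1, if_pos (Finset.mem_univ _), siteCount]

omit [Fintype Λ] [Fintype Λ'] in
/-- **Families with the same same-site relation have the same label**, whatever the lattices. -/
theorem eigLabel_eq_of_sameSite [Fintype Λ] [Fintype Λ'] {k : ℕ} (κs : Fin k → SiteCoord Λ E)
    (κs' : Fin k → SiteCoord Λ' E)
    (h : ∀ j j' : Fin k, (κs j').1 = (κs j).1 ↔ (κs' j').1 = (κs' j).1) :
    eigLabel κs = eigLabel κs' := by
  rw [eigLabel_eq_sum_factors, eigLabel_eq_sum_factors]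
  refine Finset.sum_congr rfl fun j _ => ?_
  congr 2
  refine Finset.sum_congr rfl fun j' _ => ?_
  by_cases hc : (κs j').1 = (κs j).1
  · rw [if_pos hc, if_pos ((h j j').1 hc)]
  · rw [if_neg hc, if_neg (mt (h j j').2 hc)]

/-- **Relabelling the sites along an injection preserves the label.** -/
theorem eigLabel_map_embedding (φ : Λ ↪ Λ') {k : ℕ} (κs : Fin k → SiteCoord Λ E) :
    eigLabel (fun j => ((φ (κs j).1, (κs j).2) : SiteCoord Λ' E)) = eigLabel κs := by
  refine (eigLabel_eq_of_sameSite κs _ fun j j' => ?_).symm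
  exact ⟨fun h => by rw [h], fun h => φ.injective h⟩

/-- **`labelSet` grows along injections of lattices.** -/
theorem labelSet_subset_of_embedding (φ : Λ ↪ Λ') (N : ℕ) :
    labelSet Λ E N ⊆ labelSet Λ' E N := by
  intro μ hμ
  obtain ⟨k, hk, κs, rfl⟩ := mem_labelSet.1 hμ
  exact mem_labelSet.2 ⟨k, hk, fun j => (φ (κs j).1, (κs j).2), (eigLabel_map_embedding φ κs).symm⟩

/-- **Compression**: a site monomial of degree `k ≤ |Λ|` over ANY lattice `Λ'` has the label of some
site monomial of degree `k` over `Λ` (inject its at most `k` used sites into `Λ`). -/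
theorem exists_eigLabel_eq_of_le_card {k : ℕ} (hk : k ≤ Fintype.card Λ)
    (κs' : Fin k → SiteCoord Λ' E) :
    ∃ κs : Fin k → SiteCoord Λ E, eigLabel κs = eigLabel κs' := by
  classical
  -- the used sites
  set T : Finset Λ' := Finset.univ.image fun j => (κs' j).1
  have hT : Fintype.card ↥T ≤ Fintype.card Λ := by
    rw [Fintype.card_coe]
    exact le_trans (le_trans Finset.card_image_le (by simp)) hk
  obtain ⟨ψ⟩ := Function.Embedding.nonempty_of_card_le hT
  have hmem : ∀ j, (κs' j).1 ∈ T := fun j => Finset.mem_image.2 ⟨j, Finset.mem_univ _, rfl⟩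
  refine ⟨fun j => (ψ ⟨(κs' j).1, hmem j⟩, (κs' j).2), eigLabel_eq_of_sameSite _ _ fun j j' => ?_⟩
  constructor
  · intro h
    have := ψ.injective h
    exact congrArg Subtype.val this
  · intro h
    show ψ ⟨(κs' j').1, hmem j'⟩ = ψ ⟨(κs' j).1, hmem j⟩
    congr 1
    exact Subtype.ext h

end SameSite

/-! ## §2 Volume independence of the label set and of the solver polynomial -/

section Volume

/-- **For `N ≤ |Λ|`, every label of degree `≤ N` over any lattice `Λ'` is a label over `Λ`.** -/
theorem labelSet_subset_of_le_card {N : ℕ} (hN : N ≤ Fintype.card Λ) :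
    labelSet Λ' E N ⊆ labelSet Λ E N := by
  intro μ hμ
  obtain ⟨k, hk, κs', rfl⟩ := mem_labelSet.1 hμ
  obtain ⟨κs, h⟩ := exists_eigLabel_eq_of_le_card (Λ := Λ) (hk.trans hN) κs'
  exact mem_labelSet.2 ⟨k, hk, κs, h.symm⟩

/-- **THE LABEL SET IS THE SAME FOR ALL LATTICES WITH AT LEAST `N` SITES.** -/
theorem labelSet_eq_of_le_card {N : ℕ} (hN : N ≤ Fintype.card Λ) (hN' : N ≤ Fintype.card Λ') :
    labelSet Λ E N = labelSet Λ' E N :=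
  Finset.Subset.antisymm (labelSet_subset_of_le_card hN') (labelSet_subset_of_le_card hN)

/-- **THE UNIVERSAL SOLVER POLYNOMIAL IS VOLUME-INDEPENDENT**: for any two finite lattices with at
least `N` sites, `q_N(Λ) = q_N(Λ')` as real polynomials.  For the Engel–Schaefer series at order `k`
(degree `2(k+1)`), the polynomial in `𝔏₀` producing `S̃⁽ᵏ⁾` from its source is therefore fixed as
soon as `|Λ| ≥ 2(k+1)`. -/
theorem solverPoly_eq_of_le_card {N : ℕ} (hN : N ≤ Fintype.card Λ) (hN' : N ≤ Fintype.card Λ') :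
    solverPoly Λ E N = solverPoly Λ' E N := by
  unfold solverPoly
  rw [labelSet_eq_of_le_card hN hN']

/-- In particular the label set never shrinks or grows past `|Λ| ≥ N`: adding sites to a lattice with
at least `N` sites does not change `labelSet N` (an injection `Λ ↪ Λ'` suffices for `⊆`, the
cardinality of `Λ` for `⊇`). -/
theorem labelSet_eq_of_embedding_of_le_card (φ : Λ ↪ Λ') {N : ℕ} (hN : N ≤ Fintype.card Λ) :
    labelSet Λ E N = labelSet Λ' E N :=
  Finset.Subset.antisymm (labelSet_subset_of_embedding φ N) (labelSet_subset_of_le_card hN)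

end Volume

end Summit.Ventures.LatticeQCDFlow.Exactness

end
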